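import Mathlib
import HarnessLib
import Summits.Ventures.LatticeQCDFlow.Exactness.NCMCGeneralSpaceMarkovErgodicPairs
import Summits.Ventures.LatticeQCDFlow.Exactness.NCMCGeneralSpaceWilsonHeatBathRestart

/-!
# End to end, two legs: the BAR estimate between two torus Wilson couplings from two heat-bath restart chains converges to `ΔF` almost surely

HONEST FRAMING: exact (Metropolis-corrected) sampling algorithms for lattice gauge theory;
figures of merit are autocorrelation/cost numbers at stated couplings and volumes; no
continuum-physics claim.

Venture `LatticeQCDFlow` (cell pub-lqcd), topic `Exactness`; FANOUT row 13 (`eng-snf`, GEN-16).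
NEW WORK of the cell, not a published result; no definition is introduced; nothing is cited as a
fact.  Assembly of `NCMCGeneralSpaceMarkovErgodicPairs.lean` (two independent minorised restart
chains ⇒ BAR root consistent) with `NCMCGeneralSpaceWilsonHeatBathRestart.lean` (the heat-bath link
sweep of the torus Wilson weight is invariant and minorised by a non-zero finite measure — row 9's
`heatBathSweep_invariant` / `heatBathSweep_minorised`).

## Content

* `wilson_heatBathSweep_package` — for the torus Wilson weight `wilsonWeight ρ β` (compact second
  countable `G`, continuous `ρ`, any `β`, `d`, `L ≠ 0`) and any edge list visiting every edge: the
  heat-bath sweep is a Markov kernel leaving the weight invariant and dominating a non-zero finite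
  measure from every configuration; the weight is finite and non-zero (packaged once, used per leg).
* **`CrooksPair.tendsto_barRoot_ae_wilsonHeatBathRestartPairs`** — THE TWO-LEG ENGINE INSTANCE: for
  every Crooks pair FROM `wilsonWeight ρ β₀` TO `wilsonWeight ρ β₁` (e.g. a Jarzynski protocol in the
  coupling, with its time reversal) with `e^{−ΔF} = Z_{β₁}/Z_{β₀}`, forward evolutions launched off an
  equilibrium heat-bath chain at `β₀` and reverse evolutions off an independent equilibrium heat-bath
  chain at `β₁`, paired index by index: every root sequence of the sample Bennett equation converges
  to `ΔF` almost surely.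

NOT CLAIMED: protocols whose target weight is not a torus Wilson weight of the same `G`, `ρ`, `d`,
`L` (open-boundary / defect targets need their own heat-bath package — same proof, other action);
rates; error bars.
-/

namespace Summit.Ventures.LatticeQCDFlow.Exactness.GeneralNCMC

open MeasureTheory ProbabilityTheory Set Filter Finset
open scoped ENNReal Topology

section Wilson

open Literature.MathematicalPhysics.QuantumFieldTheory

variable {d L N : ℕ} {G : Type*} [Group G] [TopologicalSpace G] [IsTopologicalGroup G]
  (ρ : G →* Matrix (Fin N) (Fin N) ℂ) [CompactSpace G] [MeasurableSpace G] [BorelSpace G]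
  [SecondCountableTopology G]

/-- **The heat-bath package of a torus Wilson weight.**  For `wilsonWeight ρ β` and an edge list
visiting every edge: the heat-bath link sweep is Markov, leaves the weight invariant, and dominates
one non-zero finite measure from every configuration; the weight itself is finite and non-zero. -/
theorem wilson_heatBathSweep_package [NeZero L] (hρ : Continuous ρ) (β : ℝ) {l : List (Edge d L)}
    (hl : ∀ ed, ed ∈ l) :
    ∃ (_ : IsMarkovKernel (cycle (l.map (siteHeatBath (fun _ : Edge d L => haarProbability G)
        (gibbsDensity fun U : GaugeConfig d L G => β * wilsonAction ρ U)))))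
      (_ : IsFiniteMeasure (wilsonWeight (d := d) (L := L) ρ β))
      (m : Measure (GaugeConfig d L G)) (_ : IsFiniteMeasure m),
      wilsonWeight (d := d) (L := L) ρ β univ ≠ 0 ∧ m univ ≠ 0 ∧
      Kernel.Invariant (cycle (l.map (siteHeatBath (fun _ : Edge d L => haarProbability G)
        (gibbsDensity fun U : GaugeConfig d L G => β * wilsonAction ρ U))))
        (wilsonWeight (d := d) (L := L) ρ β) ∧
      ∀ z, m ≤ cycle (l.map (siteHeatBath (fun _ : Edge d L => haarProbability G)
        (gibbsDensity fun U : GaugeConfig d L G => β * wilsonAction ρ U))) z := by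
  have hS : Continuous fun U : GaugeConfig d L G => β * wilsonAction ρ U :=
    continuous_smul_wilsonAction ρ hρ β
  haveI : Nonempty (GaugeConfig d L G) := ⟨fun _ => 1⟩
  obtain ⟨ωa, -, hmin⟩ := isCompact_univ.exists_isMinOn Set.univ_nonempty hS.continuousOn
  obtain ⟨ωb, -, hmax⟩ := isCompact_univ.exists_isMaxOn Set.univ_nonempty hS.continuousOn
  have hωa : ∀ U, β * wilsonAction ρ ωa ≤ β * wilsonAction ρ U :=
    fun U => (isMinOn_iff.1 hmin) U (Set.mem_univ U)
  have hωb : ∀ U, β * wilsonAction ρ U ≤ β * wilsonAction ρ ωb :=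
    fun U => (isMaxOn_iff.1 hmax) U (Set.mem_univ U)
  have hm0 : ENNReal.ofReal (Real.exp (-(β * wilsonAction ρ ωb))) ≠ 0 := by
    rw [Ne, ENNReal.ofReal_eq_zero, not_le]; exact Real.exp_pos _
  have hM0 : ENNReal.ofReal (Real.exp (-(β * wilsonAction ρ ωa))) ≠ 0 := by
    rw [Ne, ENNReal.ofReal_eq_zero, not_le]; exact Real.exp_pos _
  have hp := measurable_gibbsDensity hS
  have hmp := fun ω => (gibbsDensity_bounds hωa hωb ω).1
  have hpM := fun ω => (gibbsDensity_bounds hωa hωb ω).2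
  have hMk := isMarkovKernel_heatBathSweep (μ := fun _ : Edge d L => haarProbability G) hp hm0
    ENNReal.ofReal_ne_top hmp hpM l
  have hfin : IsFiniteMeasure (wilsonWeight (d := d) (L := L) ρ β) := by
    rw [wilsonWeight_eq_pi_withDensity]
    exact isFiniteMeasure_pi_withDensity (μ := fun _ : Edge d L => haarProbability G)
      ENNReal.ofReal_ne_top hpM
  have h0 : wilsonWeight (d := d) (L := L) ρ β univ ≠ 0 := by
    rw [wilsonWeight_eq_pi_withDensity]
    exact pi_withDensity_univ_ne_zero hm0 hmp
  have hp_top : ∀ ω, gibbsDensity (fun U : GaugeConfig d L G => β * wilsonAction ρ U) ω ≠ ∞ :=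
    fun ω => ne_top_of_le_ne_top ENNReal.ofReal_ne_top (hpM ω)
  have hZ : ∀ i ω, siteNorm (fun _ : Edge d L => haarProbability G)
      (gibbsDensity fun U : GaugeConfig d L G => β * wilsonAction ρ U) i ω ≠ 0 := fun i ω =>
    (lt_of_lt_of_le (pos_iff_ne_zero.2 hm0) (le_siteNorm hmp i ω)).ne'
  have hZtop : ∀ i ω, siteNorm (fun _ : Edge d L => haarProbability G)
      (gibbsDensity fun U : GaugeConfig d L G => β * wilsonAction ρ U) i ω ≠ ∞ := fun i ω =>
    ne_top_of_le_ne_top ENNReal.ofReal_ne_top (siteNorm_le hpM i ω)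
  have hK : Kernel.Invariant (cycle (l.map (siteHeatBath (fun _ : Edge d L => haarProbability G)
      (gibbsDensity fun U : GaugeConfig d L G => β * wilsonAction ρ U))))
      (wilsonWeight (d := d) (L := L) ρ β) := by
    rw [wilsonWeight_eq_pi_withDensity]
    exact heatBathSweep_invariant hp hp_top hZ hZtop l
  set c : ℝ≥0∞ := (ENNReal.ofReal (Real.exp (-(β * wilsonAction ρ ωb))) *
    (ENNReal.ofReal (Real.exp (-(β * wilsonAction ρ ωa))))⁻¹) ^ l.length with hc
  have hc_top : c ≠ ∞ :=
    ENNReal.pow_ne_top (ENNReal.mul_ne_top ENNReal.ofReal_ne_top (ENNReal.inv_ne_top.2 hM0))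
  have hc0 : c ≠ 0 :=
    pow_ne_zero _ (mul_ne_zero hm0 (ENNReal.inv_ne_zero.2 ENNReal.ofReal_ne_top))
  have hmfin : IsFiniteMeasure (c • Measure.pi fun _ : Edge d L => haarProbability G) :=
    Measure.smul_finite _ hc_top
  have hmu : (c • Measure.pi fun _ : Edge d L => haarProbability G) univ ≠ 0 := by
    rw [Measure.smul_apply, smul_eq_mul, measure_univ, mul_one]
    exact hc0
  exact ⟨hMk, hfin, _, hmfin, h0, hmu, hK,
    heatBathSweep_minorised hp hm0 ENNReal.ofReal_ne_top hmp hpM hl⟩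

/-- **THE TWO-LEG ENGINE INSTANCE (BAR between two couplings).**  Torus Wilson theory, compact
second-countable `G`, continuous `ρ`; for every Crooks pair from `wilsonWeight ρ β₀` to
`wilsonWeight ρ β₁` with `e^{−ΔF} = Z_{β₁}/Z_{β₀}`, forward evolutions launched off an equilibrium
heat-bath chain at `β₀` (edge list `l₀`) and reverse evolutions off an independent equilibrium
heat-bath chain at `β₁` (edge list `l₁`), paired index by index: every sequence solving the sample
Bennett equation for all large `n` converges to `ΔF` almost surely. -/
theorem CrooksPair.tendsto_barRoot_ae_wilsonHeatBathRestartPairs [NeZero L] (hρ : Continuous ρ)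
    (β₀ β₁ : ℝ) {l₀ l₁ : List (Edge d L)} (hl₀ : ∀ ed, ed ∈ l₀) (hl₁ : ∀ ed, ed ∈ l₁)
    {E : Type*} [MeasurableSpace E] {κF κR : Kernel (GaugeConfig d L G) E} [IsMarkovKernel κF]
    [IsMarkovKernel κR] {s e : E → GaugeConfig d L G} {W : E → ℝ}
    (h : CrooksPair (wilsonWeight (d := d) (L := L) ρ β₀) (wilsonWeight (d := d) (L := L) ρ β₁)
      κF κR s e W) {ΔF : ℝ}
    (hΔF : Real.exp (-ΔF) = (((wilsonWeight (d := d) (L := L) ρ β₀) univ)⁻¹ *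
      (wilsonWeight (d := d) (L := L) ρ β₁) univ).toReal) :
    ∃ (_ : IsMarkovKernel (cycle (l₀.map (siteHeatBath (fun _ : Edge d L => haarProbability G)
        (gibbsDensity fun U : GaugeConfig d L G => β₀ * wilsonAction ρ U)))))
      (_ : IsMarkovKernel (cycle (l₁.map (siteHeatBath (fun _ : Edge d L => haarProbability G)
        (gibbsDensity fun U : GaugeConfig d L G => β₁ * wilsonAction ρ U)))))
      (_ : IsProbabilityMeasure (fwdPathLaw (wilsonWeight (d := d) (L := L) ρ β₀) κF))
      (_ : IsProbabilityMeasure (fwdPathLaw (wilsonWeight (d := d) (L := L) ρ β₁) κR)),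
    ∀ᵐ x ∂(Kernel.trajMeasure (X := fun _ : ℕ => E × E)
        ((fwdPathLaw (wilsonWeight (d := d) (L := L) ρ β₀) κF).prod
          (fwdPathLaw (wilsonWeight (d := d) (L := L) ρ β₁) κR))
        (fun k : ℕ => ((((κF ∘ₖ cycle (l₀.map (siteHeatBath (fun _ : Edge d L => haarProbability G)
            (gibbsDensity fun U : GaugeConfig d L G => β₀ * wilsonAction ρ U)))).comap s
              h.measurable_s) ∥ₖ
          ((κR ∘ₖ cycle (l₁.map (siteHeatBath (fun _ : Edge d L => haarProbability G)
            (gibbsDensity fun U : GaugeConfig d L G => β₁ * wilsonAction ρ U)))).comap e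
              h.measurable_e))).comap
          (fun hh : (j : ↥(Finset.Iic k)) → E × E => hh ⟨k, Finset.mem_Iic.2 le_rfl⟩)
          (measurable_pi_apply _))),
      ∀ dseq : ℕ → ℝ,
        (∀ᶠ n : ℕ in atTop, (∑ i ∈ range n, Real.sigmoid (dseq n - W (x i).1)) -
          ∑ i ∈ range n, Real.sigmoid (W (x i).2 - dseq n) = 0) →
        Tendsto dseq atTop (𝓝 ΔF) := by
  obtain ⟨hMk₀, hfin₀, m₀, hmfin₀, h0, hm₀, hK₀, hmin₀⟩ := wilson_heatBathSweep_package ρ hρ β₀ hl₀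
  obtain ⟨hMk₁, hfin₁, m₁, hmfin₁, h1, hm₁, hK₁, hmin₁⟩ := wilson_heatBathSweep_package ρ hρ β₁ hl₁
  haveI := hMk₀
  haveI := hMk₁
  haveI := hfin₀
  haveI := hfin₁
  haveI := hmfin₀
  haveI := hmfin₁
  haveI := isProbabilityMeasure_fwdPathLaw _ h0 κF
  haveI := isProbabilityMeasure_fwdPathLaw _ h1 κR
  exact ⟨hMk₀, hMk₁, inferInstance, inferInstance,
    h.tendsto_barRoot_ae_restartChains_of_measure_le _ _ h0 h1 hK₀ hK₁ hΔF hm₀ hm₁ hmin₀ hmin₁⟩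

end Wilson

end Summit.Ventures.LatticeQCDFlow.Exactness.GeneralNCMC
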